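import Mathlib.Combinatorics.SetFamily.FourFunctions
import Mathlib.Tactic
import HarnessLib
import HarnessLib.Audit.Tags

/-!
# `NoHeavyLowerTail` (crux stmt-CriticalPhenomena-4575), master-family line P1 (gen 27):
# the SIGNED COLOURED DAYKIN conjecture and the three-petal refined antipodal Harris count

Support file (seat `prim-masterthm-p1`, gen 27; `--supports stmt-CriticalPhenomena-4575`).  Definitions (`compatJoins`, the typed conjecture
`SignedColouredDaykin3`, the three-petal comb objects `crossJoins₃`, `crossMeets₃`, `crossPairs₃`, `payPairs₃`), no `sorry`, standard axioms.  Memo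
`run/shared/lean/prim/prim-masterthm/FROM-prim-masterthm-p1-g27-COLOURED-DAYKIN.md`.

BACKGROUND (gen 26, `…SahiRainbowJoinsTwoPetal`).  For a 3-petal sunflower system (petals `C₁, C₂, C₃`, kernel `K`, outside `O`) the 2-copy shadow of the
refined one-payer law is the REFINED ANTIPODAL GLADKOV COUNT: in every sub-cube `{B ∪ S : S ⊆ F}`,
  `#{antipodal pairs (C_i, C_j), i ≠ j} ≤ #{antipodal pairs (cross join, cross meet)}`                                                    (G_JM-comb)
(`J₂ = {x ∪ y : x ∈ C_i, y ∈ C_j, i ≠ j}`, `M₂ = {x ∩ y}`); summed with product weights it gives `e₂ = Σ_{i<j} c_i c_j ≤ μ(J₂)·μ(M₂)` for every product measure,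
a sharpening of Gladkov's `e₂ ≤ κ·o`.  Gen 26 proved the two-petal case (Daykin) and certified three petals on all of `2^≤5` (9·10⁹ sub-cube cells).

NEW HERE (gen 27, all [this work]).
* The three-petal count follows from — and led to — a purely extremal statement generalising Daykin's inequality `|𝒜 ∨ 𝒜̃| ≥ |𝒜|`:
  **SIGNED COLOURED DAYKIN (`SignedColouredDaykin3`, typed conjecture).**  Let `P` be a family of subsets of `F` containing no complementary pair, coloured by
  `c : P → Fin 3`; put `N = {F ∖ S : S ∈ P}` (coloured like `P`).  Call two members of `P ∪ N` COMPATIBLE if they have the same colour and lie on opposite sides, or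
  different colours and lie on the same side.  Then the number of distinct unions of compatible pairs is at least `|P|` (`compatJoins`).  With one colour this is
  Daykin's inequality (`card_le_card_compatJoins_of_forall_eq`, proved here from Mathlib's `Finset.le_card_infs_mul_card_sups`); with two colours it is again Daykin
  after re-signing one colour class; THREE colours is the first "frustrated" case (every re-signing of the classes leaves one incompatible cross term) and is OPEN.
* REDUCTION (`card_crossPairs₃_le_card_payPairs₃_of_signedColouredDaykin`): `SignedColouredDaykin3 ⟹ (G_JM-comb)` for three pairwise disjoint petal families in every
  sub-cube — the positive family is the set of antipodal cross pairs read in the cyclic orientation `(1,2), (2,3), (3,1)`, coloured by the petal of `B ∪ S`; compatible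
  unions are (cross-join, cross-meet) pairs by the "prism lemma" (three cases of set algebra).  No monotonicity is needed.
* EVIDENCE (memo §2; engines `code-g27/`): `SignedColouredDaykin3` holds for ALL 5 764 800 coloured signed configurations of `2^4` (exhaustive, tight in 73 686), for
  random + hill-climbing adversarial search on `2^5, 2^6` (≈ 4·10⁴ runs, thousands tight, 0 negative), also with 4 and 5 colours and in the transversality-free form
  `#compatJoins ≥ |P| − #{complementary pairs of different colours}`; (G_JM-comb) re-verified independently on all 21 121 450 three-petal systems of `2^5`
  (full cube; 161 700 tight).  Dead reductions (memo §3): single Daykin with a sub-family of the cross pairs (fails at n = 6), "good middle petal" (fails at n = 5, 960 systems),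
  matching-edge unions, two-rectangle and exchange bookkeeping.
HONEST FRAMING: one typed conjecture, one reduction, the one-colour case; `SignedColouredDaykin3`, (G_JM-comb) for three petals and the measure statement remain OPEN. [this work]
-/

namespace Summit.CriticalPhenomena.PercolationContinuityZ3.Theorems.SahiColouredDaykin

open Finset
open scoped FinsetFamily

variable {α : Type*} [DecidableEq α]

/-! ### 1. Compatible unions and the signed coloured Daykin conjecture -/

/-- **Compatible unions** of the signed coloured family generated by `P` inside `2^F` (negative side `N = {F ∖ S}` coloured like `P`):
unions of two positive members of different colours, of two negative members of different colours, and of a positive and a negative member of the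
same colour. [this work] -/
def compatJoins (F : Finset α) (P : Finset (Finset α)) (c : Finset α → Fin 3) : Finset (Finset α) :=
  (((P ×ˢ P).filter fun p => c p.1 ≠ c p.2).image fun p => p.1 ∪ p.2) ∪
    (((P ×ˢ P).filter fun p => c p.1 ≠ c p.2).image fun p => (F \ p.1) ∪ (F \ p.2)) ∪
      (((P ×ˢ P).filter fun p => c p.1 = c p.2).image fun p => p.1 ∪ (F \ p.2))

/-- Positive–positive compatible unions. [this work] -/
theorem union_mem_compatJoins {F : Finset α} {P : Finset (Finset α)} {c : Finset α → Fin 3} {S T : Finset α}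
    (hS : S ∈ P) (hT : T ∈ P) (hc : c S ≠ c T) : S ∪ T ∈ compatJoins F P c :=
  mem_union.2 (Or.inl (mem_union.2 (Or.inl
    (mem_image.2 ⟨(S, T), mem_filter.2 ⟨mem_product.2 ⟨hS, hT⟩, hc⟩, rfl⟩))))

/-- Negative–negative compatible unions. [this work] -/
theorem sdiff_union_sdiff_mem_compatJoins {F : Finset α} {P : Finset (Finset α)} {c : Finset α → Fin 3} {S T : Finset α}
    (hS : S ∈ P) (hT : T ∈ P) (hc : c S ≠ c T) : (F \ S) ∪ (F \ T) ∈ compatJoins F P c :=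
  mem_union.2 (Or.inl (mem_union.2 (Or.inr
    (mem_image.2 ⟨(S, T), mem_filter.2 ⟨mem_product.2 ⟨hS, hT⟩, hc⟩, rfl⟩))))

/-- Positive–negative compatible unions (same colour). [this work] -/
theorem union_sdiff_mem_compatJoins {F : Finset α} {P : Finset (Finset α)} {c : Finset α → Fin 3} {S T : Finset α}
    (hS : S ∈ P) (hT : T ∈ P) (hc : c S = c T) : S ∪ (F \ T) ∈ compatJoins F P c :=
  mem_union.2 (Or.inr (mem_image.2 ⟨(S, T), mem_filter.2 ⟨mem_product.2 ⟨hS, hT⟩, hc⟩, rfl⟩))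

/-- **CONJECTURE (signed coloured Daykin, three colours; typed).**  For every family `P` of subsets of `F` with no complementary pair and every
3-colouring, the compatible unions are at least as numerous as `P`.  One colour: Daykin's inequality (`card_le_card_compatJoins_of_forall_eq`); two colours:
Daykin after re-signing; exhaustive on `2^4`, adversarially tested on `2^5, 2^6` (file header). [this work] [status: open] -/
@[conjecture] def SignedColouredDaykin3 (α : Type*) [DecidableEq α] : Prop :=
  ∀ (F : Finset α) (P : Finset (Finset α)) (c : Finset α → Fin 3),
    (∀ S ∈ P, S ⊆ F) → (∀ S ∈ P, F \ S ∉ P) → #P ≤ #(compatJoins F P c)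

/-! ### 2. Set algebra in the cube `2^F` -/

/-- `(B ∪ S) ∪ (B ∪ T) = B ∪ (S ∪ T)`. [folklore] -/
private theorem union_union_eq (B S T : Finset α) : (B ∪ S) ∪ (B ∪ T) = B ∪ (S ∪ T) := by
  ext a; simp only [mem_union]; tauto

/-- `(B ∪ S) ∩ (B ∪ T) = B ∪ (S ∩ T)`. [folklore] -/
private theorem union_inter_eq (B S T : Finset α) : (B ∪ S) ∩ (B ∪ T) = B ∪ (S ∩ T) := by
  ext a; simp only [mem_union, mem_inter]; tauto

/-- `F ∖ (S ∪ T) = (F ∖ S) ∩ (F ∖ T)`. [folklore] -/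
private theorem sdiff_union_eq (F S T : Finset α) : F \ (S ∪ T) = (F \ S) ∩ (F \ T) := by
  ext a; simp only [mem_sdiff, mem_union, mem_inter]; tauto

/-- For `S' ⊆ F`: `F ∖ (S ∪ (F ∖ S')) = (F ∖ S) ∩ S'`. [folklore] -/
private theorem sdiff_union_sdiff_eq {F S S' : Finset α} (hS' : S' ⊆ F) : F \ (S ∪ (F \ S')) = (F \ S) ∩ S' := by
  ext a
  have haF : a ∈ S' → a ∈ F := fun h => hS' h
  simp only [mem_sdiff, mem_union, mem_inter]
  tauto

/-- For `S, S' ⊆ F`: `F ∖ ((F ∖ S) ∪ (F ∖ S')) = S ∩ S'`. [folklore] -/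
private theorem sdiff_sdiff_union_sdiff_eq {F S S' : Finset α} (hS : S ⊆ F) (hS' : S' ⊆ F) :
    F \ ((F \ S) ∪ (F \ S')) = S ∩ S' := by
  ext a
  have h1 : a ∈ S → a ∈ F := fun h => hS h
  have h2 : a ∈ S' → a ∈ F := fun h => hS' h
  simp only [mem_sdiff, mem_union, mem_inter]
  tauto

/-! ### 3. The one-colour case is Daykin's inequality -/

/-- **One colour: Daykin.**  If all members of `P ⊆ 2^F` have the same colour then `#P ≤ #compatJoins` — the compatible unions contain
`P ∨ P̃ = {S ∪ (F ∖ S')}`, and `|P ∨ P̃| ≥ |P|` by Daykin's inequality `|𝒜||ℬ| ≤ |𝒜 ∨ ℬ||𝒜 ∧ ℬ|` (Mathlib `Finset.le_card_infs_mul_card_sups`) together with the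
complement bijection `𝒜 ∧ 𝒜̃ ≃ 𝒜 ∨ 𝒜̃`.  No transversality is needed here. [this work] -/
theorem card_le_card_compatJoins_of_forall_eq (F : Finset α) (P : Finset (Finset α)) (c : Finset α → Fin 3)
    (hPF : ∀ S ∈ P, S ⊆ F) (hc : ∀ S ∈ P, ∀ T ∈ P, c S = c T) : #P ≤ #(compatJoins F P c) := by
  set J := compatJoins F P c with hJ
  set cpl : Finset α → Finset α := fun S => F \ S with hcpl
  set P' := P.image cpl with hP'
  have hsup : P ⊻ P' ⊆ J := by
    intro T hT
    obtain ⟨S, hS, T', hT', rfl⟩ := mem_sups.1 hT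
    obtain ⟨S', hS', rfl⟩ := mem_image.1 hT'
    exact union_sdiff_mem_compatJoins hS hS' (hc S hS S' hS')
  have hinf : P ⊼ P' ⊆ J.image cpl := by
    intro T hT
    obtain ⟨S, hS, T', hT', rfl⟩ := mem_infs.1 hT
    obtain ⟨S', hS', rfl⟩ := mem_image.1 hT'
    have hmem : S' ∪ (F \ S) ∈ J := union_sdiff_mem_compatJoins hS' hS (hc S' hS' S hS)
    refine mem_image.2 ⟨S' ∪ (F \ S), hmem, ?_⟩
    show F \ (S' ∪ (F \ S)) = S ⊓ cpl S'
    rw [sdiff_union_sdiff_eq (hPF S hS), inter_comm]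
    rfl
  have hcplinj : Set.InjOn cpl ↑P := by
    intro S hS S' hS' h
    have hSF := hPF S (mem_coe.1 hS)
    have hS'F := hPF S' (mem_coe.1 hS')
    have : F \ (F \ S) = F \ (F \ S') := by rw [show F \ S = cpl S from rfl, h]
    rwa [Finset.sdiff_sdiff_eq_self hSF, Finset.sdiff_sdiff_eq_self hS'F] at this
  have hcardP' : #P' = #P := card_image_of_injOn hcplinj
  have hday := Finset.le_card_infs_mul_card_sups P P'
  have h1 : #(P ⊻ P') ≤ #J := card_le_card hsup
  have h2 : #(P ⊼ P') ≤ #J := (card_le_card hinf).trans card_image_le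
  have hsq : #P * #P ≤ #J * #J := by
    calc #P * #P = #P * #P' := by rw [hcardP']
      _ ≤ #(P ⊼ P') * #(P ⊻ P') := hday
      _ ≤ #J * #J := Nat.mul_le_mul h2 h1
  exact Nat.mul_self_le_mul_self_iff.1 hsq

/-! ### 4. Three petals: cross joins, cross meets, antipodal cross pairs and pay pairs of a sub-cube -/

/-- Cross joins `{x ∪ y : x ∈ C_i, y ∈ C_j, i ≠ j}` of three petal families `C : Fin 3 → Finset (Finset α)`. [this work] -/
def crossJoins₃ (C : Fin 3 → Finset (Finset α)) : Finset (Finset α) :=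
  ((univ : Finset (Fin 3 × Fin 3)).filter fun ij => ij.1 ≠ ij.2).biUnion fun ij => (C ij.1 ×ˢ C ij.2).image fun p => p.1 ∪ p.2

/-- Cross meets `{x ∩ y : x ∈ C_i, y ∈ C_j, i ≠ j}`. [this work] -/
def crossMeets₃ (C : Fin 3 → Finset (Finset α)) : Finset (Finset α) :=
  ((univ : Finset (Fin 3 × Fin 3)).filter fun ij => ij.1 ≠ ij.2).biUnion fun ij => (C ij.1 ×ˢ C ij.2).image fun p => p.1 ∩ p.2

/-- Membership in the cross joins. [this work] -/
theorem union_mem_crossJoins₃ {C : Fin 3 → Finset (Finset α)} {i j : Fin 3} (hij : i ≠ j) {x y : Finset α}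
    (hx : x ∈ C i) (hy : y ∈ C j) : x ∪ y ∈ crossJoins₃ C :=
  mem_biUnion.2 ⟨(i, j), mem_filter.2 ⟨mem_univ _, hij⟩, mem_image.2 ⟨(x, y), mem_product.2 ⟨hx, hy⟩, rfl⟩⟩

/-- Membership in the cross meets. [this work] -/
theorem inter_mem_crossMeets₃ {C : Fin 3 → Finset (Finset α)} {i j : Fin 3} (hij : i ≠ j) {x y : Finset α}
    (hx : x ∈ C i) (hy : y ∈ C j) : x ∩ y ∈ crossMeets₃ C :=
  mem_biUnion.2 ⟨(i, j), mem_filter.2 ⟨mem_univ _, hij⟩, mem_image.2 ⟨(x, y), mem_product.2 ⟨hx, hy⟩, rfl⟩⟩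

/-- The antipodal CROSS pairs of the sub-cube `{B ∪ S : S ⊆ F}`, each unordered pair counted once through its member read in the cyclic orientation:
`B ∪ S ∈ C_i` and `B ∪ (F ∖ S) ∈ C_{i+1}` for some `i : Fin 3`. [this work] -/
def crossPairs₃ (C : Fin 3 → Finset (Finset α)) (B F : Finset α) : Finset (Finset α) :=
  F.powerset.filter fun S => ∃ i : Fin 3, B ∪ S ∈ C i ∧ B ∪ (F \ S) ∈ C (i + 1)

/-- The antipodal (cross-JOIN, cross-MEET) pairs of the sub-cube. [this work] -/
def payPairs₃ (C : Fin 3 → Finset (Finset α)) (B F : Finset α) : Finset (Finset α) :=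
  F.powerset.filter fun S => B ∪ S ∈ crossJoins₃ C ∧ B ∪ (F \ S) ∈ crossMeets₃ C

/-- In `Fin 3`, `i ≠ i + 1`. [folklore] -/
private theorem fin3_ne_add_one (i : Fin 3) : i ≠ i + 1 := by
  fin_cases i <;> decide

/-- In `Fin 3`, `i ≠ i + 2`. [folklore] -/
private theorem fin3_ne_add_two (i : Fin 3) : i ≠ i + 1 + 1 := by
  fin_cases i <;> decide

/-- `i ↦ i + 1` is injective on `Fin 3`. [folklore] -/
private theorem fin3_add_one_injective {i j : Fin 3} (h : i + 1 = j + 1) : i = j := by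
  fin_cases i <;> fin_cases j <;> first | rfl | (exfalso; revert h; decide)

/-- The petal index ("tail") of a configuration, for pairwise disjoint petals. [this work] -/
private def tail (C : Fin 3 → Finset (Finset α)) (x : Finset α) : Fin 3 :=
  if x ∈ C 0 then 0 else if x ∈ C 1 then 1 else 2

/-- For pairwise disjoint petals, `tail C x = i` whenever `x ∈ C i`. [this work] -/
private theorem tail_eq_of_mem {C : Fin 3 → Finset (Finset α)} (hC : ∀ i j : Fin 3, i ≠ j → Disjoint (C i) (C j))
    {x : Finset α} {i : Fin 3} (hx : x ∈ C i) : tail C x = i := by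
  have key : ∀ j : Fin 3, j ≠ i → x ∉ C j := fun j hj hxj => (disjoint_left.1 (hC j i hj) hxj) hx
  unfold tail
  split_ifs with h0 h1
  · by_contra hne
    exact key 0 hne h0
  · by_contra hne
    exact key 1 hne h1
  · fin_cases i
    · exact absurd hx h0
    · exact absurd hx h1
    · rfl

/-! ### 5. The reduction: signed coloured Daykin ⟹ refined antipodal Gladkov count for three petals -/

/-- **`SignedColouredDaykin3 ⟹ (G_JM-comb)` for three pairwise disjoint petal families, in every sub-cube.**  The positive family is `crossPairs₃`
(cyclic orientation), the colour of `S` is the petal of `B ∪ S`; the "prism lemma" puts every compatible union into `payPairs₃`: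
positive–positive `S ∪ S'` (petals of `B∪S, B∪S'` differ, petals of the antipodes differ), negative–negative `(F∖S) ∪ (F∖S')` (symmetric), and
positive–negative of the same type `S ∪ (F∖S')` (the join of a `C_i`- and a `C_{i+1}`-point, antipode the meet of a `C_{i+1}`- and a `C_i`-point). [this work] -/
theorem card_crossPairs₃_le_card_payPairs₃_of_signedColouredDaykin (h : SignedColouredDaykin3 α)
    {C : Fin 3 → Finset (Finset α)} (hC : ∀ i j : Fin 3, i ≠ j → Disjoint (C i) (C j)) (B F : Finset α) :
    #(crossPairs₃ C B F) ≤ #(payPairs₃ C B F) := by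
  set P := crossPairs₃ C B F with hP
  set c : Finset α → Fin 3 := fun S => tail C (B ∪ S) with hc
  -- unpacking membership in `P`
  have memP : ∀ {S}, S ∈ P → S ⊆ F ∧ B ∪ S ∈ C (c S) ∧ B ∪ (F \ S) ∈ C (c S + 1) := by
    intro S hS
    obtain ⟨hSF, i, h1, h2⟩ := mem_filter.1 hS
    have hi : c S = i := tail_eq_of_mem hC h1
    refine ⟨mem_powerset.1 hSF, ?_, ?_⟩
    · rw [hi]; exact h1
    · rw [hi]; exact h2
  have memPay : ∀ {T}, T ⊆ F → B ∪ T ∈ crossJoins₃ C → B ∪ (F \ T) ∈ crossMeets₃ C → T ∈ payPairs₃ C B F :=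
    fun {T} hT h1 h2 => mem_filter.2 ⟨mem_powerset.2 hT, h1, h2⟩
  -- hypotheses of the conjecture
  have hPF : ∀ S ∈ P, S ⊆ F := fun S hS => (memP hS).1
  have htrans : ∀ S ∈ P, F \ S ∉ P := by
    intro S hS hS'
    obtain ⟨hSF, h1, h2⟩ := memP hS
    obtain ⟨_, h1', h2'⟩ := memP hS'
    rw [Finset.sdiff_sdiff_eq_self hSF] at h2'
    -- B ∪ (F∖S) ∈ C (c S + 1) ∩ C (c (F∖S)) ⇒ c (F∖S) = c S + 1; B ∪ S ∈ C (c S) ∩ C (c (F∖S) + 1) ⇒ c S = c S + 1 + 1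
    have e1 : c (F \ S) = c S + 1 := by
      by_contra hne
      exact (disjoint_left.1 (hC _ _ hne) h1') h2
    have e2 : c S = c (F \ S) + 1 := by
      by_contra hne
      exact (disjoint_left.1 (hC _ _ hne) h1) h2'
    rw [e1] at e2
    exact fin3_ne_add_two (c S) e2
  -- compatible unions are pay pairs (prism lemma)
  have hsub : compatJoins F P c ⊆ payPairs₃ C B F := by
    intro T hT
    rcases mem_union.1 hT with hT | hT
    · rcases mem_union.1 hT with hT | hT
      · -- positive–positive, different colours
        obtain ⟨⟨S, S'⟩, hSS', rfl⟩ := mem_image.1 hT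
        obtain ⟨hmem, hne⟩ := mem_filter.1 hSS'
        obtain ⟨hS, hS'⟩ := mem_product.1 hmem
        obtain ⟨hSF, hS1, hS2⟩ := memP hS
        obtain ⟨hS'F, hS'1, hS'2⟩ := memP hS'
        have hne' : c S + 1 ≠ c S' + 1 := fun e => hne (fin3_add_one_injective e)
        refine memPay (union_subset hSF hS'F) ?_ ?_
        · rw [← union_union_eq]; exact union_mem_crossJoins₃ hne hS1 hS'1
        · rw [sdiff_union_eq, ← union_inter_eq]; exact inter_mem_crossMeets₃ hne' hS2 hS'2
      · -- negative–negative, different colours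
        obtain ⟨⟨S, S'⟩, hSS', rfl⟩ := mem_image.1 hT
        obtain ⟨hmem, hne⟩ := mem_filter.1 hSS'
        obtain ⟨hS, hS'⟩ := mem_product.1 hmem
        obtain ⟨hSF, hS1, hS2⟩ := memP hS
        obtain ⟨hS'F, hS'1, hS'2⟩ := memP hS'
        have hne' : c S + 1 ≠ c S' + 1 := fun e => hne (fin3_add_one_injective e)
        refine memPay (union_subset sdiff_subset sdiff_subset) ?_ ?_
        · rw [← union_union_eq]; exact union_mem_crossJoins₃ hne' hS2 hS'2
        · rw [sdiff_sdiff_union_sdiff_eq hSF hS'F, ← union_inter_eq]; exact inter_mem_crossMeets₃ hne hS1 hS'1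
    · -- positive–negative, same colour
      obtain ⟨⟨S, S'⟩, hSS', rfl⟩ := mem_image.1 hT
      obtain ⟨hmem, heq⟩ := mem_filter.1 hSS'
      obtain ⟨hS, hS'⟩ := mem_product.1 hmem
      obtain ⟨hSF, hS1, hS2⟩ := memP hS
      obtain ⟨hS'F, hS'1, hS'2⟩ := memP hS'
      have h12 : c S ≠ c S' + 1 := by rw [heq]; exact fin3_ne_add_one (c S')
      have h21 : c S + 1 ≠ c S' := by rw [heq]; exact (fin3_ne_add_one (c S')).symm
      refine memPay (union_subset hSF sdiff_subset) ?_ ?_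
      · rw [← union_union_eq]; exact union_mem_crossJoins₃ h12 hS1 hS'2
      · rw [sdiff_union_sdiff_eq hS'F, ← union_inter_eq]; exact inter_mem_crossMeets₃ h21 hS2 hS'1
  exact (h F P c hPF htrans).trans (card_le_card hsub)

end Summit.CriticalPhenomena.PercolationContinuityZ3.Theorems.SahiColouredDaykin
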